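import Summits.ResolutionOfSingularities.ResolutionOfSingularities.Theorems.EquisingularLiftEquisingularLiftNatCentreCodimTwo
import HarnessLib

/-!
# [OURS · L1 W4.5(b) · EL♮(3)] T-DIM-CENTRE — the carrier-curve datum `hdimZ₉` («the reduced carrier `Z̃₉` has 1-dimensional local rings at its
# closed points»): read off the curve step ONCE, transported to every section `Z̃ ≅ Z̃₉`, and turned into `hFrame` at every round
# (crux `EquisingularLiftNatThree` stmt-ResolutionOfSingularities-20148 / parent EL♮ stmt-…-20038; S1/S2 input (c))

NOT a statement of any manuscript. Helper file of the chain res-L1-w45b (cell `res-hironaka`, slot W4.5(b)); OURS; AI-written, weaker than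
expert review; `--supports stmt-ResolutionOfSingularities-20148 --as helper` by res-L1-w45b-stub-3 g7. No `sorry`; standard axioms; no definitions.

WHY. The round bricks of res-D-pv-029 / res-L1-w45b-stub-4 (…NatTowerRootsDischarge p570221: `Tower.inv₂_coneRound_new_sec`, `…_curveStep_sec`)
receive the centre `𝒞` of a round only through the GENERIC callback of `Tower.inv₂_coneRound_new` (model square `hsq`, `𝒞.comap jG = 𝓘⟨Z⟩`,
`Flat`, `IsRegular 𝒞.subscheme`, the `Ch`-stage) — no Cartier clause, no codimension clause — so their stand-in `hFrame` («2-frames of EVERY regular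
flat centre with reduced trace `𝓘⟨Z⟩`») is not dischargeable as typed (a Cartier divisor with infinite reduced trace satisfies its hypotheses
with 1-frames). What IS available at every round is the SECTION iso `Z̃ ≅ Z̃₉` (`DirStepSec`, hoisted by RULING-8) onto the FIXED carrier curve
`Z̃₉ = redSub F₉ Z₉ hZ₉`. Hence the dischargeable currency: ONE tower-level datum
  `hdimZ₉ : ∀ z : Z̃₉, IsClosed {z} → dim 𝒪_{Z̃₉,z} = 1`,
(a) PROVED at the tower's birth (curve step) from `TCPlus.MemberKC` clause (v) («codimension 2 at the closed special points») and T-DIM, by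
`forall_ringKrullDim_stalk_trace_eq_of_codim_over_closedPoint`; (b) TRANSPORTED to each section by `forall_ringKrullDim_stalk_eq_of_iso`;
(c) CONSUMED at each round by `forall_exists_twoFrame_of_model_of_carrier` (= …NatCentreCodimTwo's `forall_exists_twoFrame_of_model_of_isProper`
with `hdimZ` fed through the section iso), whose other inputs are exactly the callback's binders + T-DIM.

WHAT (namespace `…Cruxes.EquisingularLiftNat.Sections`).
* `withBotENat_eq_natCast_of_add_natCast_eq` — arithmetic in `WithBot ℕ∞` (`z + a = b ⇒ z = b - a`).
* **`ringKrullDim_stalk_trace_eq_of_codim`** — (β2) read backwards: in a model square with `V(𝒞)` flat over `O` and `𝒟 = 𝒞·𝒪_F`, at a point `z` of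
  `V(𝒟)` where `dim (𝒪_{X,jz} ⧸ 𝒞_{jz}) + 2 = dim 𝒪_{X,jz} = n + 1` and `n = d + 2`: `dim 𝒪_{V(𝒟),z} = d`.
* **`forall_ringKrullDim_stalk_trace_eq_of_codim_over_closedPoint`** — hence `hdimZ₉` from MemberKC (v) + T-DIM (the closed points of `V(𝒟)` map to
  closed points of `X` over the closed point).
* **`forall_ringKrullDim_stalk_eq_of_iso`** — transport of «`dim 𝒪 = d` at closed points» along `δ : C ⟶ C'`, `IsIso δ` (the section iso).
* **`forall_exists_twoFrame_of_model_of_carrier`** — `hFrame`/`hCframe` at a round over a PROPER stage: callback binders (`hsq`, `hCD : 𝒞.comap jG = 𝒟`,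
  `Flat`, `hX`, `h𝒞`) + T-DIM `hdimX` + the carrier datum `hdimZ₉` + the section iso `δ : V(𝒟) ⟶ C₉`.

References: [cite: Matsumura1987, Thm. 14.2, Thm. 15.1, Thm. 16.2]; [cite: StacksProject, Tags 00KW, 01J7]. Tree: …NatCentreCodimTwo (this seat,
p568469), res-D-pv-013 …NatStalkDimension (T-DIM), res-L1-w45b-stub-4 …NatTowerRootsDischarge (consumer), res-D-pv-029 …NatTowerConeRound / …NatTowerInvDefs.
-/

set_option linter.dupNamespace false -- mandated namespace `Summit.<Summit>.<Problem>` of this single-conjunct summit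

noncomputable section

open CategoryTheory CategoryTheory.Limits AlgebraicGeometry TopologicalSpace Topology IsLocalRing
open Literature.AlgebraicGeometry.Resolution
open AlgebraicGeometry.Scheme.IdealSheafData
open Summit.ResolutionOfSingularities.ResolutionOfSingularities.Cruxes.EquisingularLift.StrataSplit

namespace Summit.ResolutionOfSingularities.ResolutionOfSingularities.Cruxes.EquisingularLiftNat.Sections

universe u

/-- Cancellation in `WithBot ℕ∞`: `z + a = b` with `a ≤ b` natural forces `z = b - a`. [folklore] -/
theorem withBotENat_eq_natCast_of_add_natCast_eq {z : WithBot ℕ∞} {a b : ℕ}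
    (h : z + (a : WithBot ℕ∞) = (b : WithBot ℕ∞)) (hab : a ≤ b) : z = ((b - a : ℕ) : WithBot ℕ∞) := by
  induction z using WithBot.recBotCoe with
  | bot =>
    rw [WithBot.bot_add] at h
    exact absurd h (WithBot.bot_ne_coe)
  | coe c =>
    induction c using ENat.recTopCoe with
    | top =>
      have h' : ((⊤ : ℕ∞) : WithBot ℕ∞) + (a : WithBot ℕ∞) = ((⊤ : ℕ∞) : WithBot ℕ∞) := by
        rw [← WithBot.coe_natCast, ← WithBot.coe_add, top_add]
      rw [h'] at h
      exact absurd (WithBot.coe_injective h) (ENat.top_ne_coe b)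
    | coe m =>
      have h' : ((m + a : ℕ) : WithBot ℕ∞) = (b : WithBot ℕ∞) := by
        rw [← h]; push_cast; rfl
      have : m + a = b := by exact_mod_cast h'
      have hm : m = b - a := by omega
      subst hm; rfl

/-! ## The carrier datum from the codimension clause ((β2) read backwards) -/

/-- **`dim 𝒪_{V(𝒟),z} = d` from the codimension clause at `j z`.** In a model square `(j, t; r, Spec θ)` over a DVR, for `𝒞` with `V(𝒞)`
flat over `O` and `𝒟 = 𝒞·𝒪_F`, at a point `z` of `V(𝒟)` with `dim (𝒪_{X,jz} ⧸ 𝒞_{jz}) + 2 = dim 𝒪_{X,jz}`, `dim 𝒪_{X,jz} = n + 1` and `n = d + 2`: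
`dim 𝒪_{V(𝒟),z} = d` (by `ringKrullDim_quotient_stalkIdeal_eq_of_model`, `dim (𝒪_{X,jz} ⧸ 𝒞_{jz}) = dim 𝒪_{V(𝒟),z} + 1`).
[cite: Matsumura1987, Thm. 15.1] [cite: StacksProject, Tag 00KW] [OURS · L1 W4.5b]; NOT a statement of the manuscript. -/
theorem ringKrullDim_stalk_trace_eq_of_codim (O : Type) [CommRing O] [IsDomain O] [IsDiscreteValuationRing O]
    (k : Type) [Field k] (θ : O →+* k) (hθ : Function.Surjective θ) {X F : Scheme.{0}} (r : X ⟶ Spec (.of O))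
    (j : F ⟶ X) (t : F ⟶ Spec (.of k)) (hsq : IsPullback j t r (Spec.map (CommRingCat.ofHom θ)))
    [IsLocallyNoetherian X] (𝒞 : X.IdealSheafData) [Flat (𝒞.subschemeι ≫ r)] {𝒟 : F.IdealSheafData}
    (hCD : 𝒞.comap j = 𝒟) (z : ↥𝒟.subscheme) {n d : ℕ} (hnd : n = d + 2)
    (hcodim : ringKrullDim (X.presheaf.stalk (j (𝒟.subschemeι z)) ⧸ stalkIdeal 𝒞 (j (𝒟.subschemeι z))) + 2 =
      ringKrullDim (X.presheaf.stalk (j (𝒟.subschemeι z))))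
    (hdimX : ringKrullDim (X.presheaf.stalk (j (𝒟.subschemeι z))) = ((n + 1 : ℕ) : WithBot ℕ∞)) :
    ringKrullDim (𝒟.subscheme.presheaf.stalk z) = (d : WithBot ℕ∞) := by
  have h1 := ringKrullDim_quotient_stalkIdeal_eq_of_model O k θ hθ r j t hsq 𝒞 hCD z
  rw [h1, hdimX, hnd, add_assoc] at hcodim
  have h3 : ringKrullDim (𝒟.subscheme.presheaf.stalk z) + ((3 : ℕ) : WithBot ℕ∞) = ((d + 3 : ℕ) : WithBot ℕ∞) := by
    rw [← hcodim]; norm_num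
  rw [withBotENat_eq_natCast_of_add_natCast_eq h3 (by omega)]
  simp

/-- **The carrier datum `hdimZ₉` from clause (v) of the member and T-DIM.** In a model square over a DVR, for `𝒞` with `V(𝒞)` flat over `O` and
`𝒟 = 𝒞·𝒪_F` (the curve step: `𝒞 = 𝓢 ⊔ K`, `𝒟 = 𝓘⟨Z₉⟩`, `V(𝒟) = Z̃₉`): if at every CLOSED `x ∈ supp 𝒞` over the closed point
`dim (𝒪_{X,x} ⧸ 𝒞_x) + 2 = dim 𝒪_{X,x}` (`TCPlus.MemberKC` (v)) and `dim 𝒪_{X,x} = n + 1` (T-DIM `ringKrullDim_stalk_eq_succ_of_chain`), with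
`n = d + 2`, then `dim 𝒪_{V(𝒟),z} = d` at every closed point `z` of `V(𝒟)` (closed points of `V(𝒟)` go to closed points of `X` over the closed point
along the closed immersions `V(𝒟) → F → X`). [cite: Matsumura1987, Thm. 15.1] [cite: StacksProject, Tag 00KW] [OURS · L1 W4.5b] toward
`stub_elnat_coneTowerPointResolution` (stmt-ResolutionOfSingularities-20148); NOT a statement of the manuscript. -/
theorem forall_ringKrullDim_stalk_trace_eq_of_codim_over_closedPoint (O : Type) [CommRing O] [IsDomain O] [IsDiscreteValuationRing O]
    (k : Type) [Field k] (θ : O →+* k) (hθ : Function.Surjective θ) {X F : Scheme.{0}} (r : X ⟶ Spec (.of O))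
    (j : F ⟶ X) (t : F ⟶ Spec (.of k)) (hsq : IsPullback j t r (Spec.map (CommRingCat.ofHom θ)))
    [IsLocallyNoetherian X] (𝒞 : X.IdealSheafData) [Flat (𝒞.subschemeι ≫ r)] {𝒟 : F.IdealSheafData}
    (hCD : 𝒞.comap j = 𝒟) {n d : ℕ} (hnd : n = d + 2)
    (hv : ∀ x ∈ 𝒞.support, r x = closedPoint O → IsClosed ({x} : Set X) →
      ringKrullDim (X.presheaf.stalk x ⧸ stalkIdeal 𝒞 x) + 2 = ringKrullDim (X.presheaf.stalk x))
    (hdimX : ∀ x ∈ 𝒞.support, IsClosed ({x} : Set X) → r x = closedPoint O →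
      ringKrullDim (X.presheaf.stalk x) = ((n + 1 : ℕ) : WithBot ℕ∞)) :
    ∀ z : ↥𝒟.subscheme, IsClosed ({z} : Set ↥𝒟.subscheme) →
      ringKrullDim (𝒟.subscheme.presheaf.stalk z) = (d : WithBot ℕ∞) := by
  haveI : IsClosedImmersion (Spec.map (CommRingCat.ofHom θ)) := IsClosedImmersion.spec_of_surjective _ hθ
  haveI : IsClosedImmersion j := MorphismProperty.IsStableUnderBaseChange.of_isPullback hsq.flip inferInstance
  intro z hz
  -- `x = j (ι z)` is closed, in the support, over the closed point
  have hxcl : IsClosed ({j (𝒟.subschemeι z)} : Set X) := by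
    have h := (𝒟.subschemeι ≫ j).isClosedEmbedding.isClosedMap _ hz
    rwa [Set.image_singleton, Scheme.Hom.comp_apply] at h
  have hzD : (𝒟.subschemeι z : F) ∈ (𝒟.support : Set F) := by
    rw [← Scheme.IdealSheafData.range_subschemeι]; exact ⟨z, rfl⟩
  have hx : j (𝒟.subschemeι z) ∈ (𝒞.support : Set X) := by
    have h1 : (𝒟.subschemeι z : F) ∈ ((𝒞.comap j).support : Set F) := by rw [hCD]; exact hzD
    rw [Scheme.IdealSheafData.support_comap] at h1
    exact h1
  have hrx : r (j (𝒟.subschemeι z)) = closedPoint O := by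
    have : j (𝒟.subschemeι z) ∈ Set.range j := ⟨_, rfl⟩
    rw [range_eq_preimage_of_isPullback hsq, range_specMap_of_surjective_of_field θ hθ] at this
    exact this
  exact ringKrullDim_stalk_trace_eq_of_codim O k θ hθ r j t hsq 𝒞 hCD z hnd (hv _ hx hrx hxcl) (hdimX _ hx hxcl hrx)

/-! ## Transport along the section isomorphism -/

/-- **Transport of «`dim 𝒪 = d` at the closed points» along an isomorphism** `δ : C ⟶ C'` (the section iso `Z̃ ≅ Z̃₉` of `DirStepSec`,
or the centre-iso chain of a cone round). [folklore] -/
theorem forall_ringKrullDim_stalk_eq_of_iso {C C' : Scheme.{u}} (δ : C ⟶ C') [IsIso δ] {d : WithBot ℕ∞}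
    (h' : ∀ c' : C', IsClosed ({c'} : Set C') → ringKrullDim (C'.presheaf.stalk c') = d) :
    ∀ c : C, IsClosed ({c} : Set C) → ringKrullDim (C.presheaf.stalk c) = d := by
  intro c hc
  have hc' : IsClosed ({δ c} : Set C') := by
    have h := (Scheme.homeoOfIso (asIso δ)).isClosedMap _ hc
    rwa [Set.image_singleton] at h
  rw [← h' (δ c) hc']
  exact ringKrullDim_eq_of_ringEquiv (asIso (δ.stalkMap c)).commRingCatIsoToRingEquiv.symm

/-! ## The round: `hFrame` from the carrier datum through the section iso -/

/-- **`hFrame` / `hCframe` at a round, from the carrier datum.** Over a PROPER `r : X → Spec O` (a `Ch`-stage) with `X` regular and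
`dim 𝒪_{X,x} = n + 1` at the closed points of `supp 𝒞` over the closed point (T-DIM), for a centre `𝒞` with `V(𝒞)` regular and flat over `O`
whose special fibre `V(𝒟)` (`𝒟 = 𝒞·𝒪_F`, the reduced section `Z̃`) is isomorphic (`δ`, `IsIso δ` — `DirStepSec`) to a scheme `C₉` (the reduced
carrier `Z̃₉`) with `dim 𝒪_{C₉,c} = d` at its closed points, `n = d + 2`: every point of `supp 𝒞` carries a quasi-regular 2-frame of `𝒞` —
the stand-in `hFrame` of …NatTowerRootsDischarge at the round call site, from its callback binders, T-DIM and the tower-level carrier datum ONLY.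
[cite: Matsumura1987, Thm. 14.2, Thm. 15.1, Thm. 16.2] [cite: StacksProject, Tag 01J7] [OURS · L1 W4.5b] toward `stub_elnat_coneTowerPointResolution`
(stmt-ResolutionOfSingularities-20148); NOT a statement of the manuscript. -/
theorem forall_exists_twoFrame_of_model_of_carrier (O : Type) [CommRing O] [IsDomain O] [IsDiscreteValuationRing O]
    (k : Type) [Field k] (θ : O →+* k) (hθ : Function.Surjective θ) {X F : Scheme.{0}} (r : X ⟶ Spec (.of O)) [IsProper r]
    (j : F ⟶ X) (t : F ⟶ Spec (.of k)) (hsq : IsPullback j t r (Spec.map (CommRingCat.ofHom θ)))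
    [IsLocallyNoetherian X] (hX : Scheme.IsRegular X)
    (𝒞 : X.IdealSheafData) (h𝒞 : Scheme.IsRegular 𝒞.subscheme) [Flat (𝒞.subschemeι ≫ r)] {𝒟 : F.IdealSheafData}
    (hCD : 𝒞.comap j = 𝒟) {n d : ℕ} (hnd : n = d + 2)
    (hdimX : ∀ x ∈ 𝒞.support, IsClosed ({x} : Set X) → r x = closedPoint O →
      ringKrullDim (X.presheaf.stalk x) = ((n + 1 : ℕ) : WithBot ℕ∞))
    {C₉ : Scheme.{0}} (δ : 𝒟.subscheme ⟶ C₉) [IsIso δ]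
    (hdimZ₉ : ∀ c : C₉, IsClosed ({c} : Set C₉) → ringKrullDim (C₉.presheaf.stalk c) = (d : WithBot ℕ∞)) :
    ∀ x ∈ 𝒞.support, ∃ c : Fin 2 → X.presheaf.stalk x,
      Ideal.span (Set.range c) = stalkIdeal 𝒞 x ∧ IsQuasiRegular c := by
  refine forall_exists_twoFrame_of_model_of_isProper O k θ hθ r j t hsq hX 𝒞 h𝒞 hCD hnd ?_ ?_
  · intro z hzcl hrz
    have hz : j (𝒟.subschemeι z) ∈ (𝒞.support : Set X) := by
      have hzD : (𝒟.subschemeι z : F) ∈ (𝒟.support : Set F) := by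
        rw [← Scheme.IdealSheafData.range_subschemeι]; exact ⟨z, rfl⟩
      have h1 : (𝒟.subschemeι z : F) ∈ ((𝒞.comap j).support : Set F) := by rw [hCD]; exact hzD
      rw [Scheme.IdealSheafData.support_comap] at h1
      exact h1
    exact hdimX _ hz hzcl hrz
  · exact fun z hz _ => forall_ringKrullDim_stalk_eq_of_iso δ hdimZ₉ z hz

/-- The same at the CURVE STEP itself (`δ = 𝟙`: the centre's trace IS the carrier): `hFrame` from the carrier datum `hdimZ₉` on `V(𝒟) = Z̃₉`.
[cite: Matsumura1987, Thm. 14.2, Thm. 15.1, Thm. 16.2] [OURS · L1 W4.5b]; NOT a statement of the manuscript. -/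
theorem forall_exists_twoFrame_of_model_of_carrier_self (O : Type) [CommRing O] [IsDomain O] [IsDiscreteValuationRing O]
    (k : Type) [Field k] (θ : O →+* k) (hθ : Function.Surjective θ) {X F : Scheme.{0}} (r : X ⟶ Spec (.of O)) [IsProper r]
    (j : F ⟶ X) (t : F ⟶ Spec (.of k)) (hsq : IsPullback j t r (Spec.map (CommRingCat.ofHom θ)))
    [IsLocallyNoetherian X] (hX : Scheme.IsRegular X)
    (𝒞 : X.IdealSheafData) (h𝒞 : Scheme.IsRegular 𝒞.subscheme) [Flat (𝒞.subschemeι ≫ r)] {𝒟 : F.IdealSheafData}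
    (hCD : 𝒞.comap j = 𝒟) {n d : ℕ} (hnd : n = d + 2)
    (hdimX : ∀ x ∈ 𝒞.support, IsClosed ({x} : Set X) → r x = closedPoint O →
      ringKrullDim (X.presheaf.stalk x) = ((n + 1 : ℕ) : WithBot ℕ∞))
    (hdimZ₉ : ∀ z : ↥𝒟.subscheme, IsClosed ({z} : Set ↥𝒟.subscheme) →
      ringKrullDim (𝒟.subscheme.presheaf.stalk z) = (d : WithBot ℕ∞)) :
    ∀ x ∈ 𝒞.support, ∃ c : Fin 2 → X.presheaf.stalk x,
      Ideal.span (Set.range c) = stalkIdeal 𝒞 x ∧ IsQuasiRegular c :=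
  forall_exists_twoFrame_of_model_of_carrier O k θ hθ r j t hsq hX 𝒞 h𝒞 hCD hnd hdimX (𝟙 _) hdimZ₉

end Summit.ResolutionOfSingularities.ResolutionOfSingularities.Cruxes.EquisingularLiftNat.Sections

end
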